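import Mathlib
import HarnessLib
import Summits.ValiantsHypothesis.ValiantsHypothesis.Theorems.MonotoneRestorationOrbitRestorationQPSmlDeltaCalculus
import Summits.ValiantsHypothesis.ValiantsHypothesis.Theorems.MonotoneRestorationOrbitRestorationQPSmlChainRule

/-!
# The flattening bound: iterated partials of a column-symmetric set-multilinear `ΣΠΣ` polynomial
(crux `OrbitRestorationQP`, stmt-ValiantsHypothesis-18293 — lane SML: the column-set-multilinear `ΣΠΣ` stratum of A_∞)

F5b of the blueprint `SML-STRATUM-BLUEPRINT.md`.  Let `f = Σ_{t<s} Π_{b} L_{t,b}` with `L_{t,b} = Σ_a α_{t,b,a} · x_{(a,b)}` (a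
set-multilinear `ΣΠΣ` expression w.r.t. the columns `b : Fin n`) and suppose `f` is COLUMN-SYMMETRIC
(`rename (a,b) ↦ (a, τ b)` fixes `f` for every permutation `τ`).  Put `p = rename Prod.fst f`.  Then for every
`ρ : Fin j → Fin n` (`j ≤ n`) the iterated partial `∂_{ρ(0)} ⋯ ∂_{ρ(j-1)} p` lies in the span of the AT MOST `s` polynomials
`rename fst (Π_{b ≥ j} L_{t,b})`, `t < s` (`derivs_rename_fst_mem_span`).  Ingredients: the iterated chain rule
(`…SmlChainRule`), the explicit iterated derivative of a product of column-linear forms (`pderivFold_prod_linearForms`: zero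
unless the column tuple is injective), and column symmetry to move any injective column tuple to the first `j` columns.
[folklore]
-/

set_option linter.dupNamespace false

namespace Summit.ValiantsHypothesis.ValiantsHypothesis.Theorems.SmlFlattening

open MvPolynomial SmlDeltaCalculus SmlChainRule

/-! ### Derivatives of products of column-linear forms -/

/-- `∂_{(a,b₀)}` of a linear form supported in column `b`. [folklore] -/
theorem pderiv_linearForm {n : ℕ} (β : Fin n → ℂ) (b b₀ a : Fin n) :
    pderiv (a, b₀) (∑ a' : Fin n, C (β a') * X (a', b) : MvPolynomial (Fin n × Fin n) ℂ) =
      if b = b₀ then C (β a) else 0 := by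
  rw [map_sum]
  simp only [pderiv_C_mul, pderiv_X, Pi.single_apply, Prod.mk.injEq]
  by_cases hb : b = b₀
  · subst hb
    rw [if_pos rfl, Finset.sum_eq_single a]
    · simp
    · intro a' _ ha'; simp [ha']
    · intro h; exact absurd (Finset.mem_univ a) h
  · rw [if_neg hb]
    refine Finset.sum_eq_zero fun a' _ => ?_
    simp [hb]

/-- A partial derivative killing every factor kills the product. [folklore] -/
theorem pderiv_prod_eq_zero {υ ι : Type*} (v : υ) (g : ι → MvPolynomial υ ℂ) (U : Finset ι)
    (h : ∀ b ∈ U, pderiv v (g b) = 0) : pderiv v (∏ b ∈ U, g b) = 0 := by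
  classical
  induction U using Finset.induction_on with
  | empty => simp
  | insert b U hb ih =>
    rw [Finset.prod_insert hb, pderiv_mul, h b (Finset.mem_insert_self _ _),
      ih (fun b' hb' => h b' (Finset.mem_insert_of_mem hb')), zero_mul, mul_zero, add_zero]

/-- One derivative `∂_{(a,b₀)}` of `C c · Π_{b∈U} L_{t,b}`: it extracts the coefficient of `x_{(a,b₀)}` and removes the
factor of column `b₀` (or kills everything if `b₀ ∉ U`). [folklore] -/
theorem pderiv_C_mul_prod_linearForms {n : ℕ} (α : Fin n → Fin n → ℂ) (U : Finset (Fin n)) (c : ℂ) (a b₀ : Fin n) :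
    pderiv (a, b₀) (C c * ∏ b ∈ U, ∑ a' : Fin n, C (α b a') * X (a', b) : MvPolynomial (Fin n × Fin n) ℂ) =
      if b₀ ∈ U then C (c * α b₀ a) * ∏ b ∈ U.erase b₀, ∑ a' : Fin n, C (α b a') * X (a', b) else 0 := by
  rw [pderiv_C_mul]
  by_cases hb : b₀ ∈ U
  · rw [if_pos hb, ← Finset.mul_prod_erase U _ hb, pderiv_mul, pderiv_linearForm, if_pos rfl,
      pderiv_prod_eq_zero _ _ _ (fun b hb' => by
        rw [pderiv_linearForm, if_neg (Finset.ne_of_mem_erase hb')]), mul_zero, add_zero, ← mul_assoc, ← map_mul]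
  · rw [if_neg hb, pderiv_prod_eq_zero _ _ _ (fun b hb' => by
      rw [pderiv_linearForm, if_neg]
      rintro rfl
      exact hb hb'), mul_zero]

/-- **Iterated derivative of a product of column-linear forms** along row tuple `ρ` and column tuple `κ`: zero unless
`κ` is injective with values in `U`, and then the product of the extracted coefficients times the product over the
remaining columns. [folklore] -/
theorem pderivFold_prod_linearForms {n : ℕ} (α : Fin n → Fin n → ℂ) :
    ∀ (j : ℕ) (ρ κ : Fin j → Fin n) (U : Finset (Fin n)) (c : ℂ),
      List.foldl (fun (q : MvPolynomial (Fin n × Fin n) ℂ) i => pderiv (ρ i, κ i) q)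
        (C c * ∏ b ∈ U, ∑ a' : Fin n, C (α b a') * X (a', b)) (List.finRange j) =
      if Function.Injective κ ∧ ∀ i, κ i ∈ U then
        C (c * ∏ i, α (κ i) (ρ i)) * ∏ b ∈ U \ Finset.univ.image κ, ∑ a' : Fin n, C (α b a') * X (a', b)
      else 0 := by
  intro j
  induction j with
  | zero =>
    intro ρ κ U c
    rw [if_pos ⟨fun i => Fin.elim0 i, fun i => Fin.elim0 i⟩]
    simp
  | succ j ih =>
    intro ρ κ U c
    rw [List.finRange_succ, List.foldl_cons, List.foldl_map, pderiv_C_mul_prod_linearForms]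
    by_cases h0 : κ 0 ∈ U
    · rw [if_pos h0]
      rw [show (List.foldl (fun (q : MvPolynomial (Fin n × Fin n) ℂ) i => pderiv (ρ i.succ, κ i.succ) q)
          (C (c * α (κ 0) (ρ 0)) * ∏ b ∈ U.erase (κ 0), ∑ a' : Fin n, C (α b a') * X (a', b)) (List.finRange j)) =
          List.foldl (fun (q : MvPolynomial (Fin n × Fin n) ℂ) i => pderiv ((fun i => ρ i.succ) i, (fun i => κ i.succ) i) q)
          (C (c * α (κ 0) (ρ 0)) * ∏ b ∈ U.erase (κ 0), ∑ a' : Fin n, C (α b a') * X (a', b)) (List.finRange j)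
          from rfl, ih]
      -- compare the two conditions and the two right-hand sides
      have hcond : (Function.Injective (fun i : Fin j => κ i.succ) ∧ ∀ i : Fin j, κ i.succ ∈ U.erase (κ 0)) ↔
          (Function.Injective κ ∧ ∀ i, κ i ∈ U) := by
        constructor
        · rintro ⟨hinj, hmem⟩
          refine ⟨?_, fun i => Fin.cases h0 (fun i => Finset.mem_of_mem_erase (hmem i)) i⟩
          have hκ : κ = Fin.cons (κ 0) (fun i => κ i.succ) := by
            funext i; refine Fin.cases ?_ (fun i => ?_) i <;> simp
          rw [hκ]
          refine Fin.cons_injective_of_injective ?_ hinj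
          rintro ⟨i, hi⟩
          exact Finset.ne_of_mem_erase (hmem i) hi
        · rintro ⟨hinj, hmem⟩
          refine ⟨hinj.comp (Fin.succ_injective j), fun i => ?_⟩
          exact Finset.mem_erase.2 ⟨fun h => Fin.succ_ne_zero i (hinj h), hmem i.succ⟩
      by_cases hc : Function.Injective κ ∧ ∀ i, κ i ∈ U
      · rw [if_pos (hcond.2 hc), if_pos hc, Fin.prod_univ_succ, ← mul_assoc]
        congr 2
        ext b
        simp only [Finset.mem_sdiff, Finset.mem_erase, Finset.mem_image, Finset.mem_univ, true_and, not_exists]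
        constructor
        · rintro ⟨⟨hne, hbU⟩, hno⟩
          exact ⟨hbU, fun i => Fin.cases (Ne.symm hne) (fun i => hno i) i⟩
        · rintro ⟨hbU, hno⟩
          exact ⟨⟨fun h => hno 0 h.symm, hbU⟩, fun i => hno i.succ⟩
      · rw [if_neg (fun h => hc (hcond.1 h)), if_neg hc]
    · rw [if_neg h0, SmlChainRule.pderivFoldList_zero, if_neg]
      rintro ⟨_, hmem⟩
      exact h0 (hmem 0)

/-! ### Column symmetry moves injective column tuples -/

/-- Two injective maps `Fin j → Fin n` are conjugate under a permutation of `Fin n`. [folklore] -/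
theorem exists_perm_map {n j : ℕ} (κ κ' : Fin j → Fin n) (hκ : Function.Injective κ) (hκ' : Function.Injective κ') :
    ∃ g : Equiv.Perm (Fin n), ∀ i, g (κ i) = κ' i := by
  classical
  let e : {x // x ∈ Set.range κ} ≃ {x // x ∈ Set.range κ'} :=
    (Equiv.ofInjective _ hκ).symm.trans (Equiv.ofInjective _ hκ')
  refine ⟨e.extendSubtype, fun i => ?_⟩
  rw [Equiv.extendSubtype_apply_of_mem e (κ i) ⟨i, rfl⟩]
  simp only [e, Equiv.trans_apply, Equiv.ofInjective_symm_apply]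
  rfl

/-- Under column symmetry, the `rename fst`-image of an iterated derivative along `(ρ, κ)` only depends on `κ` up to
injective relabelling. [folklore] -/
theorem rename_fst_pderivFold_of_colSymm {n j : ℕ} (f : MvPolynomial (Fin n × Fin n) ℂ)
    (hcol : ∀ τ : Equiv.Perm (Fin n), rename (fun v : Fin n × Fin n => (v.1, τ v.2)) f = f)
    (ρ κ κ' : Fin j → Fin n) (hκ : Function.Injective κ) (hκ' : Function.Injective κ') :
    rename (Prod.fst : Fin n × Fin n → Fin n)
        (List.foldl (fun (q : MvPolynomial (Fin n × Fin n) ℂ) i => pderiv (ρ i, κ' i) q) f (List.finRange j)) =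
      rename (Prod.fst : Fin n × Fin n → Fin n)
        (List.foldl (fun (q : MvPolynomial (Fin n × Fin n) ℂ) i => pderiv (ρ i, κ i) q) f (List.finRange j)) := by
  obtain ⟨g, hg⟩ := exists_perm_map κ κ' hκ hκ'
  have hinj : Function.Injective (fun v : Fin n × Fin n => (v.1, g v.2)) := by
    rintro ⟨a, b⟩ ⟨a', b'⟩ h
    simp only [Prod.mk.injEq] at h
    exact Prod.ext h.1 (g.injective h.2)
  have h := rename_pderivFoldList (fun v : Fin n × Fin n => (v.1, g v.2)) hinj (fun i => (ρ i, κ i))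
    (List.finRange j) f
  rw [hcol g] at h
  simp only [hg] at h
  rw [← h, rename_rename]
  rfl

/-! ### The flattening bound -/

/-- **Flattening bound.**  For a column-symmetric set-multilinear `ΣΠΣ` expression `f = Σ_{t<s} Π_b L_{t,b}` and `j ≤ n`,
every `j`-th order iterated partial derivative of `p = rename fst f` lies in the span of the `≤ s` polynomials
`rename fst (Π_{b ∉ {0,…,j-1}} L_{t,b})`. [folklore] -/
theorem derivs_rename_fst_mem_span {n s j : ℕ} (hjn : j ≤ n) (α : Fin s → Fin n → Fin n → ℂ)
    (hcol : ∀ τ : Equiv.Perm (Fin n), rename (fun v : Fin n × Fin n => (v.1, τ v.2))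
      (∑ t : Fin s, ∏ b : Fin n, ∑ a : Fin n, C (α t b a) * X (a, b) : MvPolynomial (Fin n × Fin n) ℂ) =
      ∑ t : Fin s, ∏ b : Fin n, ∑ a : Fin n, C (α t b a) * X (a, b))
    (ρ : Fin j → Fin n) :
    List.foldl (fun (q : MvPolynomial (Fin n) ℂ) i => pderiv (ρ i) q)
        (rename (Prod.fst : Fin n × Fin n → Fin n)
          (∑ t : Fin s, ∏ b : Fin n, ∑ a : Fin n, C (α t b a) * X (a, b))) (List.finRange j) ∈
      Submodule.span ℂ ((Finset.univ.image fun t : Fin s => rename (Prod.fst : Fin n × Fin n → Fin n)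
        (∏ b ∈ Finset.univ \ Finset.univ.image (fun i : Fin j => (⟨(i : ℕ), by omega⟩ : Fin n)),
          ∑ a : Fin n, C (α t b a) * X (a, b)) : Finset (MvPolynomial (Fin n) ℂ)) : Set (MvPolynomial (Fin n) ℂ)) := by
  classical
  -- the canonical injective column tuple
  have hκ₀ : Function.Injective (fun i : Fin j => (⟨(i : ℕ), by omega⟩ : Fin n)) := by
    intro i i' h; simp only [Fin.mk.injEq] at h; exact Fin.ext h
  rw [pderivFold_rename_fst]
  refine Submodule.sum_mem _ fun κ _ => ?_
  by_cases hκ : Function.Injective κ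
  · -- move `κ` to the canonical tuple by column symmetry, then compute explicitly
    rw [rename_fst_pderivFold_of_colSymm _ hcol ρ _ κ hκ₀ hκ, pderivFoldList_sum, map_sum]
    refine Submodule.sum_mem _ fun t _ => ?_
    have h := pderivFold_prod_linearForms (α t) j ρ (fun i : Fin j => (⟨(i : ℕ), by omega⟩ : Fin n)) Finset.univ 1
    rw [map_one, one_mul] at h
    rw [h, if_pos ⟨hκ₀, fun i => Finset.mem_univ _⟩, map_mul, rename_C, one_mul]
    refine Submodule.smul_mem _ _ ?_ |> fun hm => by rw [← smul_eq_C_mul]; exact hm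
    exact Submodule.subset_span (Finset.mem_coe.2 (Finset.mem_image_of_mem _ (Finset.mem_univ t)))
  · -- non-injective column tuples give zero
    rw [pderivFoldList_sum, map_sum]
    refine Submodule.sum_mem _ fun t _ => ?_
    have h := pderivFold_prod_linearForms (α t) j ρ κ Finset.univ 1
    rw [map_one, one_mul] at h
    rw [h, if_neg (fun h' => hκ h'.1), map_zero]
    exact Submodule.zero_mem _

end Summit.ValiantsHypothesis.ValiantsHypothesis.Theorems.SmlFlattening
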